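import Mathlib
import Summits.Ventures.HodgeRepro.Tier4.Common.AdelicDefs
import Summits.Ventures.HodgeRepro.Tier4.Common.CongruenceAdeles
import Summits.Ventures.HodgeRepro.Tier4.Common.CompactOpenLevel

/-!
# Tier4/Line4/LevelCosetCongruence — (C-L4-TAIL, FINITE-PLACE HALF): COSET SPARSITY AT THE FINITE PLACES — the rational
points of a level-`N` double coset `K(N) γ₀ K(N)` are congruent to `γ₀` modulo `N` entrywise (lead g386 (R-10)(i) S14760;
plan-4 g4 §15 / L4-MATH §15.2: «the finite-place factor is non-zero only on the rational `γ` whose invariant `t(γ)` lies in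
the coset `t(γ₀) + N·Λ`»)

Blind re-derivation cell `pub-hodge-repro`, Tier 4 (README §9–§10), seat t4-L1-p3 (prover, gen 3; seated on L4's finite-place
half by the lead's word S14760; t4-L1-p4 g4 keeps `TailDominated` / `LevelTailDominated`).  Target tree path
`lean/Summits/Ventures/HodgeRepro/Tier4/Line4/LevelCosetCongruence.lean`.  Imports typer-2's `AdelicDefs` (`GA`, `GA.mat`,
`rationalPoints`, `principalGL`), `CongruenceAdeles` (`modSet`, `integralSet`, `natSize`), `CompactOpenLevel` (`finPart`,
`infPart`, `congrSet`, `IsCongr`, `levelK`, `mem_levelK`).  0 printed inputs.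

STATEMENTS (statement-first, S14760).  `IsIntegralFin W g` := every finite component of every entry of `g` is integral
(`finPart (mat g i j) ∈ integralSet`).  (A) `congrSet k N` is an IDEAL OF THE INTEGRAL ADELES: `mul_mem_congrSet_of_integral`
(`x ∈ congrSet N`, `finPart y ∈ integralSet`, `infPart y` arbitrary... — stated for `y` with `infPart y = 0 ∨` — see the
precise form), `sum_mem_congrSet`.  (B) `mat_mul_sub_mem_congrSet`: `A ≡ 1 (mod N)` (`IsCongr`), `B` finite-integral ⇒ every
entry of `A * B - B` is in `congrSet N`, and `mat_sub_mul_mem_congrSet`: every entry of `B * A - B` is in `congrSet N`.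
(C) **`mat_sub_mem_congrSet_of_mem_levelK`**: `κ κ' ∈ levelK W N`, `g` finite-integral ⇒ every entry of
`mat (κ * g * κ') - mat g` is in `congrSet k N` — THE COSET CONGRUENCE: every `γ ∈ K(N) γ₀ K(N)` is `≡ γ₀ (mod N)` entrywise.
(D) the descent to `k` for RATIONAL `γ, γ₀`: `exists_rational_mat_of_mem_rationalPoints` (the adelic matrix of a rational
point is the image of a `k`-matrix), `mem_N_smul_of_principal_mem_congrSet` (a principal adele in `congrSet N` is `N` times an
integer of `k`), and **`entry_sub_mem_N_smul_of_mem_levelK_mul`**: for `γ = κ γ₀ κ'` rational with `γ₀` finite-integral,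
every entry of the `k`-matrix of `γ − γ₀` lies in `N · 𝓞_k` — the sparse coset `t(γ) ∈ t(γ₀) + N Λ` for `t` = any entry
(hence for any `𝓞`-polynomial invariant of the entries, by (A)).  NOT claimed: the archimedean decay, the tail comparison,
`TailDominated` / `LevelTailDominated` (p4's), anything about `P_T4`.  Nothing here says anything about the status of the
Hodge conjecture for CM abelian varieties, which is NOT proved (HC_CM is NOT proved by anyone in this repository).
-/

set_option autoImplicit false

noncomputable section

namespace Summit.Ventures.HodgeRepro.Tier4.Line4

open Summit.Ventures.HodgeRepro.Tier4.Common NumberField IsDedekindDomain Matrix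
open scoped NumberField

section Ideal

variable (k : Type) [Field k] [NumberField k]

/-- (A1) `modSet N` is an ideal of the integral finite adeles: `x ∈ N·∏𝓞_v`, `y ∈ ∏𝓞_v` ⇒ `x y ∈ N·∏𝓞_v`. -/
theorem mul_mem_modSet_of_mem_integralSet {N : ℕ} {x y : FiniteAdeleRing (𝓞 k) k} (hx : x ∈ modSet k N)
    (hy : y ∈ integralSet k) : x * y ∈ modSet k N := by
  intro v
  show Valued.v (x v * y v) ≤ _
  rw [Valuation.map_mul]
  calc Valued.v (x v) * Valued.v (y v) ≤ natSize k v N * 1 :=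
        mul_le_mul' (hx v) ((HeightOneSpectrum.mem_adicCompletionIntegers (𝓞 k) k v).1 (hy v))
    _ = natSize k v N := mul_one _

/-- (A2) `congrSet N` absorbs multiplication by adeles with archimedean part `0`... — the form used: `x ∈ congrSet N` and
`finPart y ∈ integralSet` ⇒ `x * y ∈ congrSet N` (the archimedean part of `x * y` is `0 · infPart y = 0`). -/
theorem mul_mem_congrSet_of_integral {N : ℕ} {x y : Ad k} (hx : x ∈ congrSet k N)
    (hy : finPart k y ∈ integralSet k) : x * y ∈ congrSet k N :=
  ⟨by rw [map_mul, hx.1, zero_mul], by rw [map_mul]; exact mul_mem_modSet_of_mem_integralSet k hx.2 hy⟩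

/-- (A2′) the same with the integral factor on the left. -/
theorem mul_mem_congrSet_of_integral' {N : ℕ} {x y : Ad k} (hx : finPart k x ∈ integralSet k)
    (hy : y ∈ congrSet k N) : x * y ∈ congrSet k N :=
  ⟨by rw [map_mul, hy.1, mul_zero], by rw [map_mul, mul_comm]; exact mul_mem_modSet_of_mem_integralSet k hy.2 hx⟩

/-- (A3) finite sums of congruence entries are congruence entries. -/
theorem sum_mem_congrSet {N : ℕ} {ι : Type} (s : Finset ι) {f : ι → Ad k} (hf : ∀ i ∈ s, f i ∈ congrSet k N) :
    ∑ i ∈ s, f i ∈ congrSet k N :=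
  (congrSet k N).sum_mem hf

end Ideal

section Matrices

variable {k : Type} [Field k] [NumberField k]

/-- **finite-integral matrices**: every finite component of every entry is integral. -/
def IsIntegralFinMat (B : M4 k) : Prop := ∀ i j, finPart k (B i j) ∈ integralSet k

/-- (B0) a matrix `≡ 1 (mod N)` is finite-integral. -/
theorem IsIntegralFinMat.of_isCongr {N : ℕ} {A : M4 k} (hA : IsCongr k N A) : IsIntegralFinMat A := by
  intro i j
  have h : A i j = (A - 1) i j + (1 : M4 k) i j := by simp [Matrix.sub_apply]
  rw [h, map_add]
  exact add_mem_integralSet (modSet_subset_integral k N (hA i j).2) (finPart_one_apply_mem i j)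

/-- (B0″) finite sums of integral finite adeles are integral. -/
theorem sum_mem_integralSet' {ι : Type} (s : Finset ι) {f : ι → FiniteAdeleRing (𝓞 k) k}
    (hf : ∀ i ∈ s, f i ∈ integralSet k) : ∑ i ∈ s, f i ∈ integralSet k := by
  classical
  induction s using Finset.induction_on with
  | empty => simpa using zero_mem_integralSet (k := k)
  | insert a s ha ih =>
    rw [Finset.sum_insert ha]
    exact add_mem_integralSet (hf a (Finset.mem_insert_self a s)) (ih fun i hi => hf i (Finset.mem_insert_of_mem hi))

/-- (B0‴) products of integral finite adeles are integral. -/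
theorem mul_mem_integralSet' {x y : FiniteAdeleRing (𝓞 k) k} (hx : x ∈ integralSet k) (hy : y ∈ integralSet k) :
    x * y ∈ integralSet k := fun v => by
  show x v * y v ∈ _
  exact mul_mem (hx v) (hy v)

/-- (B0′) products of finite-integral matrices are finite-integral. -/
theorem IsIntegralFinMat.mul {A B : M4 k} (hA : IsIntegralFinMat A) (hB : IsIntegralFinMat B) :
    IsIntegralFinMat (A * B) := by
  intro i j
  rw [Matrix.mul_apply, map_sum]
  exact sum_mem_integralSet' Finset.univ fun l _ => by rw [map_mul]; exact mul_mem_integralSet' (hA i l) (hB l j)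

/-- (B1) `A ≡ 1 (mod N)`, `B` finite-integral ⇒ `A B ≡ B (mod N)` entrywise. -/
theorem mat_mul_sub_mem_congrSet {N : ℕ} {A B : M4 k} (hA : IsCongr k N A) (hB : IsIntegralFinMat B) (i j : Fin 4) :
    (A * B - B) i j ∈ congrSet k N := by
  have h : A * B - B = (A - 1) * B := by rw [sub_mul, one_mul]
  rw [h, Matrix.mul_apply]
  exact sum_mem_congrSet k Finset.univ fun l _ => mul_mem_congrSet_of_integral k (hA i l) (hB l j)

/-- (B2) `A ≡ 1 (mod N)`, `B` finite-integral ⇒ `B A ≡ B (mod N)` entrywise. -/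
theorem mat_sub_mul_mem_congrSet {N : ℕ} {A B : M4 k} (hA : IsCongr k N A) (hB : IsIntegralFinMat B) (i j : Fin 4) :
    (B * A - B) i j ∈ congrSet k N := by
  have h : B * A - B = B * (A - 1) := by rw [mul_sub, mul_one]
  rw [h, Matrix.mul_apply]
  exact sum_mem_congrSet k Finset.univ fun l _ => mul_mem_congrSet_of_integral' k (hB i l) (hA l j)

end Matrices

section Coset

variable {k : Type} [Field k] [NumberField k] (W : PlaneData k)

/-- **finite-integral elements of `G(𝔸_k)`**: every finite component of every matrix entry is integral. -/
def IsIntegralFin (g : GA W) : Prop := IsIntegralFinMat (GA.mat W g)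

/-- **(C) THE COSET CONGRUENCE AT THE FINITE PLACES**: for `κ, κ' ∈ K(N)` and a finite-integral `g`,
`κ g κ' ≡ g (mod N)` entrywise — every point of the double coset `K(N) g K(N)` is congruent to `g` modulo `N`. -/
theorem mat_sub_mem_congrSet_of_mem_levelK {N : ℕ} {κ κ' : GA W} (hκ : κ ∈ levelK W N) (hκ' : κ' ∈ levelK W N)
    {g : GA W} (hg : IsIntegralFin W g) (i j : Fin 4) :
    (GA.mat W (κ * g * κ') - GA.mat W g) i j ∈ congrSet k N := by
  have hA₁ : IsCongr k N (GA.mat W κ) := ((mem_levelK W N κ).mp hκ).1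
  have hA : IsCongr k N (GA.mat W κ') := ((mem_levelK W N κ').mp hκ').1
  have hmat : GA.mat W (κ * g * κ') = GA.mat W κ * GA.mat W g * GA.mat W κ' := by
    simp [GA.mat, Subgroup.coe_mul, Units.val_mul]
  have hBA : IsIntegralFinMat (GA.mat W g * GA.mat W κ') := hg.mul (IsIntegralFinMat.of_isCongr hA)
  have hsplit : GA.mat W (κ * g * κ') - GA.mat W g
      = (GA.mat W κ * (GA.mat W g * GA.mat W κ') - GA.mat W g * GA.mat W κ')
        + (GA.mat W g * GA.mat W κ' - GA.mat W g) := by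
    rw [hmat, Matrix.mul_assoc, sub_add_sub_cancel]
  rw [hsplit, Matrix.add_apply]
  exact add_mem (mat_mul_sub_mem_congrSet hA₁ hBA i j) (mat_sub_mul_mem_congrSet hA hg i j)

/-- (D1) the adelic matrix of a rational point is the image of a `k`-matrix. -/
theorem exists_rational_mat_of_mem_rationalPoints {γ : GA W} (hγ : γ ∈ rationalPoints W) :
    ∃ m : Matrix (Fin 4) (Fin 4) k, GA.mat W γ = m.map (algebraMap k (Ad k)) := by
  obtain ⟨u, hu⟩ := (MonoidHom.mem_range).mp hγ
  refine ⟨(u : Matrix (Fin 4) (Fin 4) k), ?_⟩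
  have hγ' : (γ : GL4 k) = Matrix.GeneralLinearGroup.map (algebraMap k (Ad k)) u := hu.symm
  show ((γ : GL4 k) : M4 k) = _
  rw [hγ']
  rfl

/-- (D2) a principal adele in `congrSet N` is `N` times an integer of `k` (`mem_integers_of_valuation_le_one`). -/
theorem exists_eq_N_mul_of_algebraMap_mem_congrSet {N : ℕ} (hN : N ≠ 0) {x : k}
    (hx : algebraMap k (Ad k) x ∈ congrSet k N) : ∃ z : 𝓞 k, x = (N : k) * algebraMap (𝓞 k) k z := by
  have hNk : (N : k) ≠ 0 := Nat.cast_ne_zero.mpr hN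
  have hval : ∀ v : HeightOneSpectrum (𝓞 k), v.valuation k (x / (N : k)) ≤ 1 := by
    intro v
    have h1 := hx.2 v
    have h2 : Valued.v ((finPart k (algebraMap k (Ad k) x)) v) = v.valuation k x := by
      show Valued.v ((algebraMap k (FiniteAdeleRing (𝓞 k) k) x) v) = _
      rw [FiniteAdeleRing.algebraMap_apply, HeightOneSpectrum.valuedAdicCompletion_eq_valuation']
    have h3 : natSize k v N = v.valuation k (N : k) := by
      unfold natSize
      rw [HeightOneSpectrum.valuedAdicCompletion_eq_valuation']
    rw [h2, h3] at h1
    have hN0 : v.valuation k (N : k) ≠ 0 := (Valuation.ne_zero_iff _).mpr hNk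
    rw [Valuation.map_div, div_le_one₀ (zero_lt_iff.mpr hN0)]
    exact h1
  obtain ⟨z, hz⟩ := HeightOneSpectrum.mem_integers_of_valuation_le_one k (x / (N : k)) hval
  refine ⟨z, ?_⟩
  rw [hz, mul_div_cancel₀ x hNk]

/-- **(D) THE SPARSE COSET IN `k`**: for rational `γ = κ γ₀ κ'` (`κ, κ' ∈ K(N)`, `γ₀` rational and finite-integral) the
`k`-matrices `m, m₀` of `γ, γ₀` satisfy `m i j - m₀ i j ∈ N · 𝓞_k` for every entry — `t(γ) ∈ t(γ₀) + N Λ` for `t` = any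
matrix entry, `Λ = 𝓞_k`. -/
theorem entry_sub_mem_N_smul_of_mem_levelK_mul {N : ℕ} (hN : N ≠ 0) {κ κ' γ₀ : GA W} (hκ : κ ∈ levelK W N)
    (hκ' : κ' ∈ levelK W N) (hγ₀ : γ₀ ∈ rationalPoints W) (hint : IsIntegralFin W γ₀)
    (hγ : κ * γ₀ * κ' ∈ rationalPoints W) :
    ∃ m m₀ : Matrix (Fin 4) (Fin 4) k, GA.mat W (κ * γ₀ * κ') = m.map (algebraMap k (Ad k)) ∧
      GA.mat W γ₀ = m₀.map (algebraMap k (Ad k)) ∧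
      ∀ i j, ∃ z : 𝓞 k, m i j - m₀ i j = (N : k) * algebraMap (𝓞 k) k z := by
  obtain ⟨m, hm⟩ := exists_rational_mat_of_mem_rationalPoints W hγ
  obtain ⟨m₀, hm₀⟩ := exists_rational_mat_of_mem_rationalPoints W hγ₀
  refine ⟨m, m₀, hm, hm₀, fun i j => ?_⟩
  have hc := mat_sub_mem_congrSet_of_mem_levelK W hκ hκ' hint i j
  rw [hm, hm₀, Matrix.sub_apply, Matrix.map_apply, Matrix.map_apply, ← map_sub] at hc
  exact exists_eq_N_mul_of_algebraMap_mem_congrSet hN hc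

end Coset

end Summit.Ventures.HodgeRepro.Tier4.Line4
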